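import Mathlib.Analysis.InnerProductSpace.Calculus
import Mathlib.Analysis.Calculus.Deriv.MeanValue
import Mathlib.Analysis.Calculus.Deriv.Pow
import Literature.Analysis.FunctionSpaces.PotentialDynamics
import Literature.Analysis.FunctionSpaces.PotentialDynamicsProofs
import Literature.Analysis.FunctionSpaces.PotentialDynamicsScatteringProofs
import HarnessLib

/-!
# Discharged fact: elasticity of the two-body scattering by a short-range potential

`Literature.Analysis.FunctionSpaces.PotentialDynamics` defines, for a short-range repulsive
potential `Φ` (`ShortRangePotential d`, radial profile `φ`), the scattering solutions
`IsScatteringSolution Φ w ρ y` of the reduced two-body problem `ÿ = -2∇Φ(y)` with incoming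
velocity `w` and impact parameter `ρ` (GST 2013 Part III Ch. 8 §1, display (reduced)), the
outgoing velocity `outVelocity Φ w ρ` (a `Classical.epsilon` of "limit of `ẏ` at `+∞` along a
scattering solution") and records as a named fact `norm_outVelocity Φ` the elasticity of the
scattering, `|outVelocity Φ w ρ| = |w|` for `w ≠ 0`, `ρ ≠ 0`, `ρ ⟂ w`, `|ρ| < 1`. This file proves
it (`Literature.Analysis.FunctionSpaces.norm_outVelocity_holds`), on top of the existence and
uniqueness of scattering solutions and the regularity / energy lemmas of
`PotentialDynamicsScatteringProofs` (`existsUnique_isScatteringSolution_holds`,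
`ShortRangePotential.gradient_toFun`, `ShortRangePotential.hasDerivAt_energy`,
`ShortRangePotential.norm_pos_barrier`, `IsScatteringSolution.eq_free`).

## Contents (all proved; no new definitions, no new facts)

* `ShortRangePotential.neg_two_smul_gradient_toFun_eq`: the force is central and repulsive,
  `-2∇Φ(x) = κ x` with `κ = -2φ'(|x|)/|x| ≥ 0` (`deriv_φ_mul_inv_nonpos`).
* `hasDerivAt_angularMomentumSq` (GST 2013 Ch. 8 §1: "`Φ` being radial,
  `d/dτ (δy ∧ δw) = 0`"; here in the scalar form `|x|²|v|² - ⟨x, v⟩² = |x ∧ v|²`) and the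
  Lagrange–Jacobi identity `hasDerivAt_virial` (`d/dt ⟨x, v⟩ = κ|x|² + |v|²` along `ẋ = v`,
  `v̇ = κ x`).
* Qualitative theory of an arbitrary scattering solution with `w ≠ 0`
  (`IsScatteringSolution.*`): it is the free motion, outside the range, in the remote past
  (`exists_forall_eq_free`), never reaches the origin (`ne_zero`), has energy
  `|ẏ|² + 4Φ(y) = |w|²` and angular momentum `|y|²|ẏ|² - ⟨y, ẏ⟩² = |ρ|²|w|²` (`energy_eq`,
  `angularMomentumSq_eq`), and — for `ρ ≠ 0`, `ρ ⟂ w` — leaves the range for good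
  (`exists_forall_one_lt_norm_of_le`), after which its velocity is a constant `w'` with
  `|w'| = |w|` (`exists_outgoing`, `exists_tendsto_deriv_atTop`, `norm_eq_of_tendsto`).
* `norm_outVelocity_holds`: the predicate defining the `Classical.epsilon` is satisfiable (a
  scattering solution exists by `existsUnique_isScatteringSolution_holds`, and its velocity
  converges), and *every* witness has norm `|w|`.

## On the printed proof

GST 2013 Ch. 8 Lemma 1.2 argues in polar coordinates in the plane of motion
(`ρ̇² + Ψ(ρ) = ℰ₀`, a Darboux sign argument, exit at the time `τ_*`, free motion afterwards), and
the classical relations (classical) `|w'₁|² + |w'₂|² = |w₁|² + |w₂|²` express the elasticity. The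
formalisation keeps the two conservation laws of the source but replaces the phase portrait by
the Lagrange–Jacobi identity: `V = ⟨y, ẏ⟩` satisfies `V̇ = |ẏ|² - 2|y| φ'(|y|) ≥ |ẏ|²`, and
`|ẏ|² ≥ |ρ|²|w|²/|y|²` while `|y|` does not increase, so `V` becomes positive and then `|y|²`
grows at least linearly; once `|y| > 1` the velocity is constant and the conserved energy gives
`|w'|² = |w|²`. The hypothesis `ρ ≠ 0` of the fact enters exactly through `|ρ|²|w|² > 0` (for
`ρ = 0` a degenerate turning level can trap the trajectory, see the docstring of
`norm_outVelocity`); `|ρ| < 1` is only passed on to `existsUnique_isScatteringSolution_holds`.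

## References

* I. Gallagher, L. Saint-Raymond, B. Texier, *From Newton to Boltzmann: hard spheres and
  short-range potentials*, Zurich Lectures in Advanced Mathematics, EMS (2013); arXiv:1208.5753,
  Part III Ch. 8 "Two-particle interactions", §1 "Reduced motion": displays (reduced),
  (conservation-laws), (classical), the conservation of `δy ∧ δw`, Lemma 1.2 (description of the
  reduced motion; EMS ed. presumably Lemma 8.1.2 — flagged '?'). [GallagherSaintRaymondTexier2013]
* C. Cercignani, R. Illner, M. Pulvirenti, *The Mathematical Theory of Dilute Gases* (1994),
  §4.2 (followed by GST, "following the lines of [cercignani]").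
-/

noncomputable section

open Metric Set Filter Topology InnerProductSpace
open scoped InnerProductSpace NNReal Gradient

namespace Literature.Analysis.FunctionSpaces

variable {d : Type*} [Fintype d]

/-! ## The force is central and repulsive -/

namespace ShortRangePotential

/-- The radial coefficient `φ'(|x|)/|x|` of the gradient `∇Φ(x) = (φ'(|x|)/|x|) x` is nonpositive
(repulsive potential). [folklore] -/
theorem deriv_φ_mul_inv_nonpos (Φ : ShortRangePotential d) {x : EuclideanSpace ℝ d} (hx : x ≠ 0) :
    deriv Φ.φ ‖x‖ * ‖x‖⁻¹ ≤ 0 :=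
  mul_nonpos_of_nonpos_of_nonneg (Φ.deriv_φ_nonpos (norm_pos_iff.2 hx))
    (inv_nonneg.2 (norm_nonneg _))

/-- The force `-2∇Φ(x)` is a nonnegative multiple of `x` away from the origin (central and
repulsive): `-2∇Φ(x) = κ x` with `κ = -2 φ'(|x|)/|x| ≥ 0` (GST 2013 Ch. 8 §1: "`Φ` being
radial"). [folklore] -/
theorem neg_two_smul_gradient_toFun_eq (Φ : ShortRangePotential d) {x : EuclideanSpace ℝ d}
    (hx : x ≠ 0) :
    -(2 : ℝ) • gradient Φ.toFun x = (-2 * (deriv Φ.φ ‖x‖ * ‖x‖⁻¹)) • x := by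
  rw [Φ.gradient_toFun hx, smul_smul, neg_mul]

end ShortRangePotential

/-! ## Angular momentum and the Lagrange–Jacobi identity -/

section Conservation

/-- **Conservation of angular momentum**, scalar form (GST 2013 Ch. 8 §1: `d/dτ (δy ∧ δw) = 0`
because the force is central): along a solution of `ẋ = v`, `v̇ = κ x` the Gram determinant
`|x|²|v|² - ⟨x, v⟩² = |x ∧ v|²` has zero derivative. [cite: GallagherSaintRaymondTexier2013, Part III Ch. 8 §1 (conservation of δy ∧ δw)] -/
theorem hasDerivAt_angularMomentumSq {x v : ℝ → EuclideanSpace ℝ d} {t κ : ℝ}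
    (hx : HasDerivAt x (v t) t) (hv : HasDerivAt v (κ • x t) t) :
    HasDerivAt (fun s => ‖x s‖ ^ 2 * ‖v s‖ ^ 2 - ⟪x s, v s⟫_ℝ ^ 2) 0 t := by
  have h1 : HasDerivAt (fun s => ‖x s‖ ^ 2) (2 * ⟪x t, v t⟫_ℝ) t := hx.norm_sq
  have h2 : HasDerivAt (fun s => ‖v s‖ ^ 2) (2 * ⟪v t, κ • x t⟫_ℝ) t := hv.norm_sq
  have h3 : HasDerivAt (fun s => ⟪x s, v s⟫_ℝ) (⟪x t, κ • x t⟫_ℝ + ⟪v t, v t⟫_ℝ) t :=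
    hx.inner ℝ hv
  refine ((h1.fun_mul h2).fun_sub (h3.fun_pow 2)).congr_deriv ?_
  simp only [inner_smul_right, real_inner_self_eq_norm_sq, real_inner_comm (x t) (v t)]
  push_cast
  ring

/-- **The Lagrange–Jacobi (virial) identity**: along a solution of `ẋ = v`, `v̇ = κ x`,
`d/dt ⟨x, v⟩ = κ|x|² + |v|²`. [folklore] -/
theorem hasDerivAt_virial {x v : ℝ → EuclideanSpace ℝ d} {t κ : ℝ}
    (hx : HasDerivAt x (v t) t) (hv : HasDerivAt v (κ • x t) t) :
    HasDerivAt (fun s => ⟪x s, v s⟫_ℝ) (κ * ‖x t‖ ^ 2 + ‖v t‖ ^ 2) t := by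
  have h3 : HasDerivAt (fun s => ⟪x s, v s⟫_ℝ) (⟪x t, κ • x t⟫_ℝ + ⟪v t, v t⟫_ℝ) t :=
    hx.inner ℝ hv
  refine h3.congr_deriv ?_
  simp only [inner_smul_right, real_inner_self_eq_norm_sq]

end Conservation

/-! ## Qualitative theory of scattering solutions -/

section Scattering

variable {Φ : ShortRangePotential d} {w ρ : EuclideanSpace ℝ d} {y : ℝ → EuclideanSpace ℝ d}

namespace IsScatteringSolution

/-- Newton's law along a scattering solution: `ÿ = -2∇Φ(y)`. [folklore] -/
theorem hasDerivAt_deriv (hy : IsScatteringSolution Φ w ρ y) (t : ℝ) :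
    HasDerivAt (deriv y) (-(2 : ℝ) • gradient Φ.toFun (y t)) t :=
  hy.1 t

/-- A scattering solution is differentiable, with derivative `deriv y`. [folklore] -/
theorem hasDerivAt (hy : IsScatteringSolution Φ w ρ y) (t : ℝ) : HasDerivAt y (deriv y t) t :=
  (hy.2.1 t).hasDerivAt

/-- **Free incoming motion** (a repackaging of `IsScatteringSolution.eq_free` with
`one_le_norm_freeLine`): far in the past a scattering solution with nonzero incoming velocity is
the free motion `ρ + t w`, with velocity `w`, outside the range (`|y(t)| ≥ 1`). [cite: GallagherSaintRaymondTexier2013, Part III Ch. 8 §1 (free motion outside the range)] -/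
theorem exists_forall_eq_free (hy : IsScatteringSolution Φ w ρ y) (hw : w ≠ 0) :
    ∃ T, ∀ t ≤ T, 1 ≤ ‖y t‖ ∧ y t = ρ + t • w ∧ deriv y t = w := by
  obtain ⟨T, hT₀, hT⟩ := hy.eq_free hw (-(1 + ‖ρ‖) / ‖w‖)
  refine ⟨T, fun t ht => ⟨?_, hT t ht⟩⟩
  rw [(hT t ht).1]
  exact one_le_norm_freeLine hw (ht.trans hT₀)

/-- **No collision** (GST 2013 Ch. 8 §1: the conservation laws imply "`ρ > 0` for all times";
here via the energy barrier `ShortRangePotential.norm_pos_barrier`): a scattering solution with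
nonzero incoming velocity never reaches the origin. [cite: GallagherSaintRaymondTexier2013, Part III Ch. 8 §1 ("implying ρ > 0 for all times")] -/
theorem ne_zero (hy : IsScatteringSolution Φ w ρ y) (hw : w ≠ 0) (t : ℝ) : y t ≠ 0 := by
  obtain ⟨r₀, hr₀, hr₀1, hφ⟩ := Φ.exists_barrier_radius (‖w‖ ^ 2)
  obtain ⟨T, hT₀, hT⟩ := hy.eq_free hw (-(1 + ‖ρ‖) / ‖w‖)
  have hb : ∀ t, r₀ < ‖y t‖ :=
    Φ.norm_pos_barrier hr₀ hr₀1 hφ hy.hasDerivAt (fun t _ => hy.hasDerivAt_deriv t) hT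
      fun t ht => one_le_norm_freeLine hw (ht.trans hT₀)
  exact norm_pos_iff.1 (hr₀.trans (hb t))

/-- **Conservation of energy along a scattering solution**: `|ẏ(t)|² + 4Φ(y(t)) = |w|²` for all
`t` (GST 2013 Ch. 8 §1, (conservation-laws), in the normalisation of
`ShortRangePotential.hasDerivAt_energy`; the constant is evaluated in the remote past, where the
motion is free and outside the range). [cite: GallagherSaintRaymondTexier2013, Part III Ch. 8 §1, conservation laws] -/
theorem energy_eq (hy : IsScatteringSolution Φ w ρ y) (hw : w ≠ 0) (t : ℝ) :
    ‖deriv y t‖ ^ 2 + 4 * Φ.toFun (y t) = ‖w‖ ^ 2 := by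
  obtain ⟨T, hT⟩ := hy.exists_forall_eq_free hw
  have hed : ∀ s, HasDerivAt (fun s => ‖deriv y s‖ ^ 2 + 4 * Φ.toFun (y s)) 0 s :=
    fun s => Φ.hasDerivAt_energy (hy.ne_zero hw s) (hy.hasDerivAt s) (hy.hasDerivAt_deriv s)
  have h := is_const_of_deriv_eq_zero (fun s => (hed s).differentiableAt) (fun s => (hed s).deriv)
    t T
  obtain ⟨h1, -, h3⟩ := hT T le_rfl
  rw [h, h3, Φ.toFun_eq_zero h1, mul_zero, add_zero]

/-- The force along a scattering solution is central: `ÿ = κ(t) y` with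
`κ(t) = -2φ'(|y|)/|y| ≥ 0`. [folklore] -/
theorem hasDerivAt_deriv_eq_smul (hy : IsScatteringSolution Φ w ρ y) (hw : w ≠ 0) (t : ℝ) :
    HasDerivAt (deriv y) ((-2 * (deriv Φ.φ ‖y t‖ * ‖y t‖⁻¹)) • y t) t := by
  rw [← Φ.neg_two_smul_gradient_toFun_eq (hy.ne_zero hw t)]
  exact hy.hasDerivAt_deriv t

/-- **Conservation of angular momentum along a scattering solution**:
`|y|²|ẏ|² - ⟨y, ẏ⟩² = |ρ|²|w|²` for all `t` when `ρ ⟂ w` (GST 2013 Ch. 8 §1: `δy ∧ δw` is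
conserved, and equals `ρ ∧ w` along the free incoming motion). [cite: GallagherSaintRaymondTexier2013, Part III Ch. 8 §1 (conservation of the angular momentum δy ∧ δw)] -/
theorem angularMomentumSq_eq (hy : IsScatteringSolution Φ w ρ y) (hw : w ≠ 0)
    (hρ : ⟪ρ, w⟫_ℝ = 0) (t : ℝ) :
    ‖y t‖ ^ 2 * ‖deriv y t‖ ^ 2 - ⟪y t, deriv y t⟫_ℝ ^ 2 = ‖ρ‖ ^ 2 * ‖w‖ ^ 2 := by
  obtain ⟨T, hT⟩ := hy.exists_forall_eq_free hw
  have hed : ∀ s, HasDerivAt (fun s => ‖y s‖ ^ 2 * ‖deriv y s‖ ^ 2 - ⟪y s, deriv y s⟫_ℝ ^ 2)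
      0 s :=
    fun s => hasDerivAt_angularMomentumSq (hy.hasDerivAt s) (hy.hasDerivAt_deriv_eq_smul hw s)
  have h := is_const_of_deriv_eq_zero (fun s => (hed s).differentiableAt) (fun s => (hed s).deriv)
    t T
  obtain ⟨-, h2, h3⟩ := hT T le_rfl
  rw [h, h2, h3]
  have h4 : ‖ρ + T • w‖ ^ 2 = ‖ρ‖ ^ 2 + T ^ 2 * ‖w‖ ^ 2 := by
    rw [norm_add_sq_real, inner_smul_right, hρ, norm_smul, Real.norm_eq_abs, mul_pow, sq_abs]
    ring
  have h5 : ⟪ρ + T • w, w⟫_ℝ = T * ‖w‖ ^ 2 := by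
    rw [inner_add_left, hρ, real_inner_smul_left, real_inner_self_eq_norm_sq]
    ring
  rw [h4, h5]
  ring

/-- **Escape from the range** (the formal core of GST 2013 Ch. 8 Lemma 1.2, "the configuration is
post-collisional at `τ = τ_*`", for nonzero impact parameter): a scattering solution with
`w ≠ 0`, `ρ ≠ 0`, `ρ ⟂ w` leaves the unit ball for good, `|y(t)| > 1` for `t ≥ T`. Proof by the
Lagrange–Jacobi identity: `V = ⟨y, ẏ⟩` has `V̇ = κ|y|² + |ẏ|² ≥ |ẏ|²`; if `V ≤ 0` forever then
`|y|` decreases, `|ẏ|² ≥ |ρ|²|w|²/|y(0)|² > 0` by angular momentum and `V → +∞`, absurd; once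
`V(t₁) > 0`, `|y|²` grows at least linearly. [cite: GallagherSaintRaymondTexier2013, Part III Ch. 8 §1, Lemma 1.2 (EMS ed. Lemma 8.1.2)] -/
theorem exists_forall_one_lt_norm_of_le (hy : IsScatteringSolution Φ w ρ y) (hw : w ≠ 0)
    (hρ₀ : ρ ≠ 0) (hρ : ⟪ρ, w⟫_ℝ = 0) : ∃ T, ∀ t, T ≤ t → 1 < ‖y t‖ := by
  -- notation and basic derivatives
  set κ : ℝ → ℝ := fun t => -2 * (deriv Φ.φ ‖y t‖ * ‖y t‖⁻¹) with hκ
  have hκ0 : ∀ t, 0 ≤ κ t := fun t => by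
    have := Φ.deriv_φ_mul_inv_nonpos (hy.ne_zero hw t)
    simp only [hκ]
    linarith
  have hb : ∀ t, HasDerivAt (deriv y) (κ t • y t) t := fun t => hy.hasDerivAt_deriv_eq_smul hw t
  set V : ℝ → ℝ := fun t => ⟪y t, deriv y t⟫_ℝ with hV
  have hVd : ∀ t, HasDerivAt V (κ t * ‖y t‖ ^ 2 + ‖deriv y t‖ ^ 2) t := fun t =>
    hasDerivAt_virial (hy.hasDerivAt t) (hb t)
  have hVd' : ∀ t, ‖deriv y t‖ ^ 2 ≤ deriv V t := fun t => by
    rw [(hVd t).deriv]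
    nlinarith [hκ0 t, sq_nonneg ‖y t‖]
  have hVdiff : Differentiable ℝ V := fun t => (hVd t).differentiableAt
  have hVmono : Monotone V :=
    monotone_of_deriv_nonneg hVdiff fun t => (sq_nonneg _).trans (hVd' t)
  set N : ℝ → ℝ := fun t => ‖y t‖ ^ 2 with hN
  have hNd : ∀ t, HasDerivAt N (2 * V t) t := fun t => (hy.hasDerivAt t).norm_sq
  have hNdiff : Differentiable ℝ N := fun t => (hNd t).differentiableAt
  have hΛ : ∀ t, N t * ‖deriv y t‖ ^ 2 - V t ^ 2 = ‖ρ‖ ^ 2 * ‖w‖ ^ 2 := fun t =>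
    hy.angularMomentumSq_eq hw hρ t
  have hΛ0 : 0 < ‖ρ‖ ^ 2 * ‖w‖ ^ 2 := by
    have h1 := norm_pos_iff.2 hρ₀
    have h2 := norm_pos_iff.2 hw
    positivity
  -- Step 1: the virial becomes positive
  obtain ⟨t₁, ht₁⟩ : ∃ t₁, 0 < V t₁ := by
    by_contra hcon
    push Not at hcon
    -- `N` is nonincreasing, so `N t ≤ N 0` for `t ≥ 0`
    have hNanti : Antitone N := antitone_of_deriv_nonpos hNdiff fun t => by
      rw [(hNd t).deriv]
      linarith [hcon t]
    have hN0 : 0 < N 0 := by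
      simp only [hN]
      exact pow_pos (norm_pos_iff.2 (hy.ne_zero hw 0)) 2
    set c : ℝ := ‖ρ‖ ^ 2 * ‖w‖ ^ 2 / N 0 with hc
    have hc0 : 0 < c := div_pos hΛ0 hN0
    -- lower bound on the speed for `t ≥ 0`
    have hspeed : ∀ t, 0 ≤ t → c ≤ ‖deriv y t‖ ^ 2 := fun t ht => by
      have h1 : N t ≤ N 0 := hNanti ht
      have h2 := hΛ t
      rw [hc, div_le_iff₀ hN0]
      nlinarith [sq_nonneg (V t), sq_nonneg ‖deriv y t‖]
    -- hence `V` grows at least linearly on `[0, ∞)`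
    have hgrow : ∀ t, 0 ≤ t → c * (t - 0) ≤ V t - V 0 := fun t ht =>
      (convex_Ici 0).mul_sub_le_image_sub_of_le_deriv hVdiff.continuous.continuousOn
        (hVdiff.differentiableOn) (fun s hs => by
          rw [interior_Ici] at hs
          exact (hspeed s (le_of_lt hs)).trans (hVd' s)) 0 (le_refl (0 : ℝ)) t ht ht
    set t₂ : ℝ := (|V 0| + 1) / c with ht₂
    have ht₂0 : 0 ≤ t₂ := by positivity
    have h1 := hgrow t₂ ht₂0
    have h2 : c * (t₂ - 0) = |V 0| + 1 := by
      rw [sub_zero, ht₂, mul_div_cancel₀ _ hc0.ne']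
    have h3 := hcon t₂
    have h4 : -|V 0| ≤ V 0 := neg_abs_le _
    linarith
  -- Step 2: after `t₁` the squared distance grows at least linearly
  have hgrow : ∀ t, t₁ ≤ t → 2 * V t₁ * (t - t₁) ≤ N t - N t₁ := fun t ht =>
    (convex_Ici t₁).mul_sub_le_image_sub_of_le_deriv hNdiff.continuous.continuousOn
      hNdiff.differentiableOn (fun s hs => by
        rw [interior_Ici] at hs
        rw [(hNd s).deriv]
        linarith [hVmono (le_of_lt hs)]) t₁ (le_refl t₁) t ht ht
  refine ⟨t₁ + (1 / (2 * V t₁) + 1), fun t ht => ?_⟩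
  have ht' : t₁ ≤ t := by
    have : 0 < 1 / (2 * V t₁) + 1 := by positivity
    linarith
  have h1 := hgrow t ht'
  have h2 : 1 < N t := by
    have h3 : 2 * V t₁ * (1 / (2 * V t₁) + 1) ≤ 2 * V t₁ * (t - t₁) := by
      apply mul_le_mul_of_nonneg_left _ (by positivity)
      linarith
    have h4 : 2 * V t₁ * (1 / (2 * V t₁) + 1) = 1 + 2 * V t₁ := by
      field_simp
    have h5 : 0 ≤ N t₁ := sq_nonneg _
    linarith
  simp only [hN] at h2
  exact lt_of_pow_lt_pow_left₀ 2 (norm_nonneg _) (by simpa using h2)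

/-- **The outgoing velocity** (GST 2013 Ch. 8 §1, Lemma 1.2 with the classical relations
(classical) `|w'₁|² + |w'₂|² = |w₁|² + |w₂|²`): a scattering solution with `w ≠ 0`, `ρ ≠ 0`,
`ρ ⟂ w` has an eventually constant velocity `w'` of norm `|w|` (free motion after leaving the
range, and conservation of `¼|ẏ|² + Φ(y)`). [cite: GallagherSaintRaymondTexier2013, Part III Ch. 8 §1, Lemma 1.2 & (classical)] -/
theorem exists_outgoing (hy : IsScatteringSolution Φ w ρ y) (hw : w ≠ 0) (hρ₀ : ρ ≠ 0)
    (hρ : ⟪ρ, w⟫_ℝ = 0) : ∃ T w', ‖w'‖ = ‖w‖ ∧ ∀ t, T ≤ t → deriv y t = w' := by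
  obtain ⟨T, hT⟩ := hy.exists_forall_one_lt_norm_of_le hw hρ₀ hρ
  have hS : IsOpen (Ioi T) := isOpen_Ioi
  have hS' : IsPreconnected (Ioi T) := isPreconnected_Ioi
  have hmem : T + 1 ∈ Ioi T := by simp
  have hd2 : ∀ t ∈ Ioi T, HasDerivAt (deriv y) 0 t := fun t ht => by
    have h := hy.hasDerivAt_deriv t
    rwa [Φ.gradient_toFun_eq_zero (hT t (le_of_lt ht)).le, smul_zero] at h
  have hconst : ∀ t ∈ Ioi T, deriv y t = deriv y (T + 1) := fun t ht =>
    hS.is_const_of_deriv_eq_zero hS'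
      (fun s hs => (hd2 s hs).differentiableAt.differentiableWithinAt)
      (fun s hs => (hd2 s hs).deriv) ht hmem
  refine ⟨T + 1, deriv y (T + 1), ?_, fun t ht => hconst t (lt_of_lt_of_le (lt_add_one T) ht)⟩
  have h1 := hy.energy_eq hw (T + 1)
  rw [Φ.toFun_eq_zero (hT (T + 1) (le_of_lt (lt_add_one T))).le, mul_zero, add_zero] at h1
  exact (pow_left_inj₀ (norm_nonneg _) (norm_nonneg _) two_ne_zero).1 h1

/-- The velocity of a scattering solution (`w ≠ 0`, `ρ ≠ 0`, `ρ ⟂ w`) has a limit at `+∞`, of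
norm `|w|`. [cite: GallagherSaintRaymondTexier2013, Part III Ch. 8 §1, Lemma 1.2 & (classical)] -/
theorem exists_tendsto_deriv_atTop (hy : IsScatteringSolution Φ w ρ y) (hw : w ≠ 0)
    (hρ₀ : ρ ≠ 0) (hρ : ⟪ρ, w⟫_ℝ = 0) :
    ∃ w', ‖w'‖ = ‖w‖ ∧ Tendsto (deriv y) atTop (𝓝 w') := by
  obtain ⟨T, w', hw', hT⟩ := hy.exists_outgoing hw hρ₀ hρ
  refine ⟨w', hw', tendsto_const_nhds.congr' ?_⟩
  filter_upwards [eventually_ge_atTop T] with t ht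
  exact (hT t ht).symm

/-- **Elasticity for a given scattering solution**: if the velocity of a scattering solution
(`w ≠ 0`, `ρ ≠ 0`, `ρ ⟂ w`) tends to `w'` at `+∞`, then `|w'| = |w|`. [cite: GallagherSaintRaymondTexier2013, Part III Ch. 8 §1, (classical)] -/
theorem norm_eq_of_tendsto (hy : IsScatteringSolution Φ w ρ y) (hw : w ≠ 0) (hρ₀ : ρ ≠ 0)
    (hρ : ⟪ρ, w⟫_ℝ = 0) {w' : EuclideanSpace ℝ d} (h : Tendsto (deriv y) atTop (𝓝 w')) :
    ‖w'‖ = ‖w‖ := by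
  obtain ⟨w₁, hw₁, h₁⟩ := hy.exists_tendsto_deriv_atTop hw hρ₀ hρ
  rw [tendsto_nhds_unique h h₁, hw₁]

end IsScatteringSolution

end Scattering

/-! ## The discharge -/

section Discharge

variable (Φ : ShortRangePotential d)

/-- **Elastic scattering** — discharge of the named fact `norm_outVelocity` (GST 2013 Part III
Ch. 8 §1: the conservation laws (conservation-laws) and the classical relations (classical),
`|w'₁|² + |w'₂|² = |w₁|² + |w₂|²`, i.e. `|δw(τ_*)| = |δw₀|` for the reduced motion, which is free
after the exit time `τ_*` of Lemma 1.2): for `w ≠ 0`, `ρ ≠ 0`, `ρ ⟂ w`, `|ρ| < 1` the outgoing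
velocity `outVelocity Φ w ρ` has norm `|w|`. Since `outVelocity` is a `Classical.epsilon`, the
proof shows (i) that the defining predicate is satisfiable — a scattering solution exists
(`existsUnique_isScatteringSolution_holds`) and its velocity converges
(`IsScatteringSolution.exists_tendsto_deriv_atTop`) — and (ii) that *every* scattering solution
whose velocity converges to some `w'` has `|w'| = |w|`
(`IsScatteringSolution.norm_eq_of_tendsto`). [cite: GallagherSaintRaymondTexier2013, Part III Ch. 8 §1, (conservation-laws), (classical) and Lemma 1.2 (EMS ed. Lemma 8.1.2 '?')] -/
theorem norm_outVelocity_holds : norm_outVelocity Φ := by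
  intro w ρ hw hρ₀ hρ hρ'
  obtain ⟨y, hy⟩ := (existsUnique_isScatteringSolution_holds Φ hw hρ hρ').exists
  obtain ⟨w', -, hw'⟩ := hy.exists_tendsto_deriv_atTop hw hρ₀ hρ
  have hex : ∃ w₁, ∃ y, IsScatteringSolution Φ w ρ y ∧ Tendsto (deriv y) atTop (𝓝 w₁) :=
    ⟨w', y, hy, hw'⟩
  obtain ⟨y₁, hy₁, h₁⟩ := Classical.epsilon_spec hex
  exact hy₁.norm_eq_of_tendsto hw hρ₀ hρ h₁

end Discharge

end Literature.Analysis.FunctionSpaces
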